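import Summits.Langlands.Langlands.Theses.FunctorialPrimitivitySplit
import Summits.Langlands.Langlands.Theorems.FunctorialPrimitivitySplitPFTAlgebra
import Literature.NumberTheory.Automorphic.SatakeParamNeZeroProofs
import HarnessLib

/-!
# Proof of `FunctorialPrimitivitySplit.PolynomialFunctorTransport` (stmt-Langlands-28168)

The support item PFT of route `FunctorialPrimitivitySplit` (binder `hP` of its `closes`):
Satake-compatible semisimple ℓ-adic avatars pass through a POLYNOMIAL functor
`r : ∏ᵢ GL_{aᵢ}(ℂ) → GL_n(ℂ)`.  Given cuspidal `πᵢ` on `GL_{aᵢ}/K` with semisimple avatars `ρᵢ`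
(a.e. `SatakeFrobCompatibleAt ι πᵢ ρᵢ v`) and a cuspidal `π` on `GL_n/K` whose Satake parameters
at almost every `v` are the eigenvalues of `r (diag αᵢ)ᵢ` for every listing `αᵢ` of the parameters
of the `πᵢ`, the avatar of `π` is the SEMISIMPLIFICATION of `r_ℓ ∘ (ρ₁, …, ρ_k)`, where `r_ℓ` is
`r` transported along `ι : \bar ℚ_ℓ ≃ ℂ` (coefficients `ι⁻¹ P`).

* `exists_framedRep_apply_eq` — `g ↦ r_ℓ (ρ₁ g, …, ρ_k g)` is a continuous homomorphism
  `Γ_K → GL_n(\bar ℚ_ℓ)` (polynomial entries are continuous; multiplicativity on invertible tuples).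
* `satakeFrobCompatibleAt_of_apply_eq` — the place-by-place computation: at an arithmetic Frobenius
  `σ` at `v`, `ι charpoly (ρᵢ σ) = ∏ (X - α_{ij}⁻¹)`, so by part I
  (`charpoly_apply_eq_charpoly_apply_diagonal`, Schur form + torus degeneration)
  `ι charpoly (r_ℓ (ρᵢ σ)ᵢ) = charpoly (r (diag αᵢ⁻¹)ᵢ) = charpoly ((r (diag αᵢ)ᵢ)⁻¹)`, whose roots
  are the inverses of the prescribed Satake parameter `β = roots (charpoly (r (diag αᵢ)ᵢ))` of `π`
  (`charpoly_inv_eq_prod_roots`) — i.e. `arithFrobPolyOfSatake ι q_v 1 β`.  Satake parameters are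
  non-zero (`Literature.NumberTheory.Automorphic.hasSatakeParamAt_ne_zero_holds`).
* `Summit.Langlands.Langlands.Theorems.polynomialFunctorTransport_proof` — the item, after
  semisimplification (`FramedGaloisRep.exists_semisimplification`: same characteristic polynomials,
  unramified where the original is).

No uniqueness of Satake parameters and no named unproved fact is used.
References: Buzzard–Gee, *The conjectural connections between automorphic representations and
Galois representations* (2014), Conj. 3.2.1 / Rem. 3.2.5 [BuzzardGeeLMS2014]; Horn–Johnson,
*Matrix Analysis*, Thm. 2.3.1 [HornJohnson2013]; J. A. Green, LNM 830 (1980), §2.6.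
-/

noncomputable section

set_option linter.dupNamespace false

open scoped Matrix Polynomial NumberField MatrixGroups
open Polynomial Matrix Filter IsDedekindDomain Field
open Literature.NumberTheory.Automorphic Literature.NumberTheory.GaloisRepresentations

namespace Summit.Langlands.Langlands.Theorems.PolynomialFunctorTransportKit

variable {k : ℕ} {a : Fin k → ℕ} {n : ℕ}

/-- **The composite framed representation.**  For a map `rl : ∏ᵢ M_{aᵢ}(A) → M_n(A)` with
polynomial entries, `rl 1 = 1`, multiplicative on invertible tuples, and framed continuous
representations `ρᵢ : G → GL_{aᵢ}(A)`, the map `g ↦ rl (ρ₁ g, …, ρ_k g)` is (the matrix of) a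
framed continuous representation `G → GL_n(A)` (inverse `rl (ρᵢ g⁻¹)ᵢ`; continuity of polynomial
maps, Mathlib `MvPolynomial.continuous_eval`). [folklore] -/
theorem exists_framedRep_apply_eq {G : Type*} [Group G] [TopologicalSpace G]
    {A : Type*} [CommRing A] [TopologicalSpace A] [IsTopologicalRing A]
    (Pl : Fin n → Fin n → MvPolynomial ((i : Fin k) × (Fin (a i) × Fin (a i))) A)
    (rl : ((i : Fin k) → Matrix (Fin (a i)) (Fin (a i)) A) → Matrix (Fin n) (Fin n) A)
    (hrl : ∀ (M : (i : Fin k) → Matrix (Fin (a i)) (Fin (a i)) A) (s t : Fin n),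
      rl M s t = MvPolynomial.eval (fun x => M x.1 x.2.1 x.2.2) (Pl s t))
    (h1 : rl 1 = 1)
    (hmul : ∀ M N : (i : Fin k) → Matrix (Fin (a i)) (Fin (a i)) A,
      (∀ i, IsUnit (M i)) → (∀ i, IsUnit (N i)) → rl (M * N) = rl M * rl N)
    (ρs : (i : Fin k) → FramedRep G A (a i)) :
    ∃ ρ : FramedRep G A n, ∀ g : G,
      ((ρ g : GL (Fin n) A) : Matrix (Fin n) (Fin n) A) =
        rl fun i => ((ρs i g : GL (Fin (a i)) A) : Matrix (Fin (a i)) (Fin (a i)) A) := by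
  have hu : ∀ (g : G) (i : Fin k),
      IsUnit (((ρs i g : GL (Fin (a i)) A)) : Matrix (Fin (a i)) (Fin (a i)) A) :=
    fun g i => Units.isUnit _
  have hu' : ∀ (g : G) (i : Fin k),
      IsUnit ((((ρs i g)⁻¹ : GL (Fin (a i)) A)) : Matrix (Fin (a i)) (Fin (a i)) A) :=
    fun g i => Units.isUnit _
  have hvi : ∀ g : G, (rl fun i => ((ρs i g : GL (Fin (a i)) A) : Matrix (Fin (a i)) (Fin (a i)) A)) *
      (rl fun i => (((ρs i g)⁻¹ : GL (Fin (a i)) A) : Matrix (Fin (a i)) (Fin (a i)) A)) = 1 := by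
    intro g
    rw [← hmul _ _ (hu g) (hu' g)]
    have e : ((fun i => ((ρs i g : GL (Fin (a i)) A) : Matrix (Fin (a i)) (Fin (a i)) A)) *
        fun i => (((ρs i g)⁻¹ : GL (Fin (a i)) A) : Matrix (Fin (a i)) (Fin (a i)) A)) = 1 := by
      funext i; simp only [Pi.mul_apply, Pi.one_apply, Units.mul_inv]
    rw [e, h1]
  have hiv : ∀ g : G, (rl fun i => (((ρs i g)⁻¹ : GL (Fin (a i)) A) : Matrix (Fin (a i)) (Fin (a i)) A)) *
      (rl fun i => ((ρs i g : GL (Fin (a i)) A) : Matrix (Fin (a i)) (Fin (a i)) A)) = 1 := by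
    intro g
    rw [← hmul _ _ (hu' g) (hu g)]
    have e : ((fun i => (((ρs i g)⁻¹ : GL (Fin (a i)) A) : Matrix (Fin (a i)) (Fin (a i)) A)) *
        fun i => ((ρs i g : GL (Fin (a i)) A) : Matrix (Fin (a i)) (Fin (a i)) A)) = 1 := by
      funext i; simp only [Pi.mul_apply, Pi.one_apply, Units.inv_mul]
    rw [e, h1]
  -- polynomial maps are continuous
  have hcont : ∀ (M : G → (i : Fin k) → Matrix (Fin (a i)) (Fin (a i)) A),
      (∀ i j l, Continuous fun g => M g i j l) → Continuous fun g => rl (M g) := by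
    intro M hM
    refine continuous_matrix fun s t => ?_
    simp_rw [hrl]
    exact (MvPolynomial.continuous_eval (Pl s t)).comp (continuous_pi fun x => hM x.1 x.2.1 x.2.2)
  refine ⟨
    { toFun := fun g => ⟨rl fun i => ((ρs i g : GL (Fin (a i)) A) : Matrix (Fin (a i)) (Fin (a i)) A),
        rl fun i => (((ρs i g)⁻¹ : GL (Fin (a i)) A) : Matrix (Fin (a i)) (Fin (a i)) A),
        hvi g, hiv g⟩
      map_one' := ?_
      map_mul' := ?_
      continuous_toFun := ?_ }, fun g => rfl⟩
  · apply Units.ext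
    simp only [map_one, Units.val_one]
    exact h1
  · intro g h
    apply Units.ext
    simp only [map_mul, Units.val_mul]
    rw [← hmul _ _ (hu g) (hu h)]
    rfl
  · refine Units.continuous_iff.2 ⟨?_, ?_⟩
    · exact hcont (fun g i => ((ρs i g : GL (Fin (a i)) A) : Matrix (Fin (a i)) (Fin (a i)) A))
        fun i j l => (Units.continuous_val.comp (map_continuous (ρs i))).matrix_elem j l
    · exact hcont (fun g i => (((ρs i g)⁻¹ : GL (Fin (a i)) A) : Matrix (Fin (a i)) (Fin (a i)) A))
        fun i j l => (Units.continuous_coe_inv.comp (map_continuous (ρs i))).matrix_elem j l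

/-- **Satake–Frobenius compatibility passes through a polynomial functor, place by place.**
With `r`, `P` as in the item, `rl` any map with `ι (rl M) = r (ι M)` and `rl 1 = 1`, and a framed
`ρ` with matrices `ρ g = rl (ρᵢ g)ᵢ`: if at `v` the Satake parameters of `π` are the eigenvalues of
`r (diag αᵢ)ᵢ` for every listing `αᵢ` of Satake parameters of the `πᵢ`, and every `(πᵢ, ρᵢ)` is
Satake–Frobenius compatible at `v`, then so is `(π, ρ)`.  Computation: `ι charpoly (ρᵢ σ) =
∏ⱼ (X - α_{ij}⁻¹)` (`arithFrobPolyOfSatake_one`), hence `ι charpoly (ρ σ) = charpoly (r (diag αᵢ⁻¹)ᵢ)`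
(`charpoly_apply_eq_charpoly_apply_diagonal`) `= charpoly ((r (diag αᵢ)ᵢ)⁻¹) = ∏_{b ∈ β} (X - b⁻¹)`
(`charpoly_inv_eq_prod_roots`), `β` the prescribed parameter of `π`; Satake parameters are non-zero
(`hasSatakeParamAt_ne_zero_holds`). [cite: BuzzardGeeLMS2014, Conj. 3.2.1 and Rem. 3.2.5] -/
theorem satakeFrobCompatibleAt_of_apply_eq {K : Type} [Field K] [NumberField K]
    {ℓ : ℕ} [Fact ℓ.Prime] (ι : PadicAlgCl ℓ ≃+* ℂ)
    (P : Fin n → Fin n → MvPolynomial ((i : Fin k) × (Fin (a i) × Fin (a i))) ℂ)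
    (r : ((i : Fin k) → Matrix (Fin (a i)) (Fin (a i)) ℂ) → Matrix (Fin n) (Fin n) ℂ)
    (hr : ∀ (M : (i : Fin k) → Matrix (Fin (a i)) (Fin (a i)) ℂ) (s t : Fin n),
      r M s t = MvPolynomial.eval (fun x => M x.1 x.2.1 x.2.2) (P s t))
    (h1 : r 1 = 1)
    (hmul : ∀ M N : (i : Fin k) → Matrix (Fin (a i)) (Fin (a i)) ℂ,
      (∀ i, IsUnit (M i)) → (∀ i, IsUnit (N i)) → r (M * N) = r M * r N)
    (rl : ((i : Fin k) → Matrix (Fin (a i)) (Fin (a i)) (PadicAlgCl ℓ)) →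
      Matrix (Fin n) (Fin n) (PadicAlgCl ℓ))
    (hrlι : ∀ M : (i : Fin k) → Matrix (Fin (a i)) (Fin (a i)) (PadicAlgCl ℓ),
      (rl M).map (ι : PadicAlgCl ℓ →+* ℂ) = r fun i => (M i).map (ι : PadicAlgCl ℓ →+* ℂ))
    (hrl1 : rl 1 = 1)
    {hc : ∀ i, isCompact_glFiniteIntegralLevel (a i) K} {hcpt : isCompact_glFiniteIntegralLevel n K}
    (πs : (i : Fin k) → CuspidalAutomorphicRepData (a i) K (hc i))
    (π : CuspidalAutomorphicRepData n K hcpt)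
    (ρs : (i : Fin k) → FramedGaloisRep K (PadicAlgCl ℓ) (a i))
    (ρ : FramedGaloisRep K (PadicAlgCl ℓ) n)
    (hρ : ∀ g, ((ρ g : GL (Fin n) (PadicAlgCl ℓ)) : Matrix (Fin n) (Fin n) (PadicAlgCl ℓ)) =
      rl fun i => ((ρs i g : GL (Fin (a i)) (PadicAlgCl ℓ)) :
        Matrix (Fin (a i)) (Fin (a i)) (PadicAlgCl ℓ)))
    (v : HeightOneSpectrum (𝓞 K))
    (hIMG : ∀ α : (i : Fin k) → Fin (a i) → ℂ,
      (∀ i, (πs i).1.HasSatakeParamAt v (Finset.univ.val.map (α i))) →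
        π.1.HasSatakeParamAt v (r fun i => Matrix.diagonal (α i)).charpoly.roots)
    (hSFC : ∀ i, Summit.Langlands.SatakeFrobCompatibleAt ι (πs i).1 (ρs i) v) :
    Summit.Langlands.SatakeFrobCompatibleAt ι π.1 ρ v := by
  classical
  choose αm hπs hur hfrob using hSFC
  have hcard : ∀ i, Multiset.card (αm i) = a i := fun i => (hπs i).card_eq
  choose α0 hα0 using fun i => exists_univ_val_map_eq (αm i) (hcard i)
  have hmem : ∀ i j, α0 i j ∈ αm i := fun i j => by
    rw [← hα0 i]; exact Multiset.mem_map_of_mem _ (Finset.mem_univ_val j)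
  have hne : ∀ i j, α0 i j ≠ 0 := fun i j => hasSatakeParamAt_ne_zero_holds (hπs i) _ (hmem i j)
  have hπs' : ∀ i, (πs i).1.HasSatakeParamAt v (Finset.univ.val.map (α0 i)) := fun i => by
    rw [hα0 i]; exact hπs i
  refine ⟨(r fun i => Matrix.diagonal (α0 i)).charpoly.roots, hIMG α0 hπs', ?_, ?_⟩
  · -- unramified: `rl 1 = 1`
    intro 𝔓 h𝔓 σ hσ
    have h1s : ∀ i, ρs i σ = 1 := fun i => hur i 𝔓 h𝔓 σ hσ
    apply Units.ext
    rw [hρ σ]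
    simp only [h1s, Units.val_one]
    exact hrl1
  · -- Frobenius characteristic polynomial
    intro 𝔓 h𝔓 σ hσ
    have hPi : ∀ i, (((ρs i σ : GL (Fin (a i)) (PadicAlgCl ℓ)) :
        Matrix (Fin (a i)) (Fin (a i)) (PadicAlgCl ℓ))).charpoly =
          arithFrobPolyOfSatake ι v.residueCard 1 (αm i) :=
      fun i => hfrob i 𝔓 h𝔓 σ hσ
    apply Polynomial.map_injective (ι : PadicAlgCl ℓ →+* ℂ) (ι : PadicAlgCl ℓ →+* ℂ).injective
    rw [FramedRep.charpoly, hρ σ, ← Matrix.charpoly_map, hrlι]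
    -- the complexified Frobenius matrices `Gᵢ = ι (ρᵢ σ)`
    set G : (i : Fin k) → Matrix (Fin (a i)) (Fin (a i)) ℂ := fun i =>
      (((ρs i σ : GL (Fin (a i)) (PadicAlgCl ℓ)) : Matrix (Fin (a i)) (Fin (a i)) (PadicAlgCl ℓ))).map
        (ι : PadicAlgCl ℓ →+* ℂ) with hG
    have hGu : ∀ i, IsUnit (G i) := fun i => by
      simp only [hG]; rw [← RingHom.mapMatrix_apply]; exact (Units.isUnit (ρs i σ)).map _
    have hGcp : ∀ i, (G i).charpoly = ((αm i).map fun b => X - C b⁻¹).prod := by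
      intro i
      simp only [hG]
      rw [Matrix.charpoly_map, hPi i, arithFrobPolyOfSatake_one, Polynomial.map_multiset_prod,
        Multiset.map_map]
      congr 1
      refine Multiset.map_congr rfl fun b _ => ?_
      simp
    have hd : ∀ i, Finset.univ.val.map (fun j => (α0 i j)⁻¹) = (G i).charpoly.roots := by
      intro i
      rw [hGcp i]
      have e : ((αm i).map fun b => X - C b⁻¹) = ((αm i).map (fun b => b⁻¹)).map fun b => X - C b := by
        rw [Multiset.map_map]; rfl
      rw [e, Polynomial.roots_multiset_prod_X_sub_C, ← hα0 i, Multiset.map_map]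
      rfl
    rw [charpoly_apply_eq_charpoly_apply_diagonal P r hr h1 hmul G hGu (fun i j => (α0 i j)⁻¹) hd]
    -- `r (diag αᵢ⁻¹)ᵢ = (r (diag αᵢ)ᵢ)⁻¹`
    have hDD' : ((fun i => Matrix.diagonal (α0 i)) * fun i => Matrix.diagonal fun j => (α0 i j)⁻¹) =
        (1 : (i : Fin k) → Matrix (Fin (a i)) (Fin (a i)) ℂ) := by
      funext i
      simp only [Pi.mul_apply, Matrix.diagonal_mul_diagonal, Pi.one_apply]
      rw [← Matrix.diagonal_one]; congr 1; funext j; exact mul_inv_cancel₀ (hne i j)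
    have hD'D : ((fun i => Matrix.diagonal fun j => (α0 i j)⁻¹) * fun i => Matrix.diagonal (α0 i)) =
        (1 : (i : Fin k) → Matrix (Fin (a i)) (Fin (a i)) ℂ) := by
      funext i
      simp only [Pi.mul_apply, Matrix.diagonal_mul_diagonal, Pi.one_apply]
      rw [← Matrix.diagonal_one]; congr 1; funext j; exact inv_mul_cancel₀ (hne i j)
    have hDu : ∀ i, IsUnit (Matrix.diagonal (α0 i)) := fun i =>
      isUnit_iff_exists.2 ⟨Matrix.diagonal fun j => (α0 i j)⁻¹,
        by simpa using congr_fun hDD' i, by simpa using congr_fun hD'D i⟩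
    have hD'u : ∀ i, IsUnit (Matrix.diagonal fun j => (α0 i j)⁻¹) := fun i =>
      isUnit_iff_exists.2 ⟨Matrix.diagonal (α0 i),
        by simpa using congr_fun hD'D i, by simpa using congr_fun hDD' i⟩
    have e1 : (r fun i => Matrix.diagonal (α0 i)) * (r fun i => Matrix.diagonal fun j => (α0 i j)⁻¹) = 1 := by
      rw [← hmul _ _ hDu hD'u, hDD', h1]
    have e2 : (r fun i => Matrix.diagonal fun j => (α0 i j)⁻¹) * (r fun i => Matrix.diagonal (α0 i)) = 1 := by
      rw [← hmul _ _ hD'u hDu, hD'D, h1]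
    have hinv : (r fun i => Matrix.diagonal fun j => (α0 i j)⁻¹) =
        (r fun i => Matrix.diagonal (α0 i))⁻¹ := (Matrix.inv_eq_right_inv e1).symm
    rw [hinv, charpoly_inv_eq_prod_roots _ (isUnit_iff_exists.2 ⟨_, e1, e2⟩),
      arithFrobPolyOfSatake_one, Polynomial.map_multiset_prod, Multiset.map_map]
    congr 1
    refine Multiset.map_congr rfl fun b _ => ?_
    simp

end Summit.Langlands.Langlands.Theorems.PolynomialFunctorTransportKit

namespace Summit.Langlands.Langlands.Theorems

open PolynomialFunctorTransportKit in
/-- **`PolynomialFunctorTransport` (item stmt-Langlands-28168) holds.**  The avatar of `π` is the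
semisimplification (`FramedGaloisRep.exists_semisimplification`) of `r_ℓ ∘ (ρ₁, …, ρ_k)`
(`exists_framedRep_apply_eq`, with `r_ℓ` = `r` transported along `ι`, coefficients `ι⁻¹ P`:
`exists_transport`); Satake–Frobenius compatibility at almost every place is
`satakeFrobCompatibleAt_of_apply_eq`, on the cofinite intersection of the IMG set and the
compatibility sets of the `ρᵢ` (`Filter.eventually_all`).
[cite: BuzzardGeeLMS2014, Conj. 3.2.1 and Rem. 3.2.5] -/
theorem polynomialFunctorTransport_proof :
    Summit.Langlands.Langlands.Theses.FunctorialPrimitivitySplit.PolynomialFunctorTransport := by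
  intro K _ _ n hcpt hn k a hc πs r hrP π hπalg hπsalg hIMG ℓ _ ι hρs
  obtain ⟨⟨P, hP⟩, h1, hmul⟩ := hrP
  classical
  choose ρs hρss hρsc using hρs
  obtain ⟨Pl, rl, hrl, hrl1, hrlmul, hrlι⟩ := exists_transport ι P r hP h1 hmul
  obtain ⟨ρ', hρ'⟩ := exists_framedRep_apply_eq Pl rl hrl hrl1 hrlmul ρs
  obtain ⟨ρ, hss, -, -, hur, hfr⟩ := FramedGaloisRep.exists_semisimplification ρ'
  refine ⟨ρ, hss, (hIMG.and (Filter.eventually_all.2 hρsc)).mono fun v hv => ?_⟩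
  obtain ⟨β, hπβ, hu, hf⟩ := satakeFrobCompatibleAt_of_apply_eq ι P r hP h1 hmul rl hrlι hrl1
    πs π ρs ρ' hρ' v hv.1 hv.2
  exact ⟨β, hπβ, hur v hu, hfr v _ hf⟩

end Summit.Langlands.Langlands.Theorems

end
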